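import Summits.Ventures.Crystal3D.Bulk.SphPolygonFan
import Summits.Ventures.Crystal3D.Bulk.HexPerimeterDefs
import Summits.Ventures.Crystal3D.Bulk.SphSegmentCap
import HarnessLib

/-!
# Cutting a convex spherical polygon by a great circle: the clipped polygon is convex, has no
# larger perimeter, contains the cut cone and keeps the caps — brick (S5) of (d3)

HONEST FRAMING. Part of the venture `Summits/Ventures/Crystal3D` (cell `pub-crystal3d`, phase 2;
seat typer-bulk-2), generic and configuration-free; nothing here mentions GAP(1.26). Setting as
in `Bulk/SphPolygonFan.lean`: a periodic window-convex polygon `w` (period `n ≥ 3`) and a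
cutting normal `ν` whose vertex signs `⟪w i, ν⟫` read `> 0` on `0, …, k−1` and `≤ 0` on
`k, …, n−1` with some strictly negative one (the normal form delivered by `exists_sign_block`
after a rotation). In the perimeter proof of the census row (d3) (`phase2/theory1/HEX-PERIMETER.md`,
plan `HOME/lean/hexper/README.md` S5/S6) the face is clipped by the two common tangent great
circles of the two rattler caps, one after the other; this file is one clipping step:

* `cross3` bilinearity helpers, `eq_of_forall_inner_eq`, `mem_span_pair_of_nonneg`;
* the clipped polygon `cutPoly w ν n k` (defined in `Bulk/HexPerimeterDefs.lean`): vertices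
  `w 0, …, w (k−1), B, A` with the crossing points `B = cutB = σ(k−1) w k − σ k w (k−1)` and
  `A = cutA = σ 0 w (n−1) − σ (n−1) w 0`, period `k + 2`;
* `cutPoly_convex_std` — it is in convex position (one period; the window form follows with
  `convexPos_window` of `Bulk/SphPolygonCap.lean`); `cutPoly_inner_nonneg` / `cutPoly_inherit` — its
  vertices are on the closed positive side of `ν` and inherit every closed half-space containing
  the old vertices; `orient3_cutB_cutA_eq` / `cross3_cutB_cutA` — the new edge lies on `ν⊥`
  (its functional is a positive multiple of `⟪·, ν⟫`); `cutPoly_cone` — its closed cone contains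
  the old closed cone cut by `{⟪·,ν⟫ ≥ 0}`; `cutPoly_caps` — if every old edge plane and `ν⊥`
  are at height `≥ s` over a point `z`, so is every new edge plane;
The perimeter comparison is `Bulk/SphPolygonCutPerim.lean`.
-/

noncomputable section

namespace Summit.Ventures.Crystal3D

open Literature.Geometry.DiscreteGeometry Real InnerProductGeometry Finset
open scoped InnerProductSpace RealInnerProductSpace

/-! ## Part A. Bilinearity of the cross product -/

/-- `cross3` is additive in the second argument. -/
theorem cross3_add_right (u v v' : EuclideanSpace ℝ (Fin 3)) : cross3 u (v + v') = cross3 u v + cross3 u v' := by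
  ext i; fin_cases i <;> simp [cross3] <;> ring

/-- `cross3` is homogeneous in the second argument. -/
theorem cross3_smul_right (u v : EuclideanSpace ℝ (Fin 3)) (c : ℝ) : cross3 u (c • v) = c • cross3 u v := by
  ext i; fin_cases i <;> simp [cross3] <;> ring

/-- `cross3` is additive in the first argument. -/
theorem cross3_add_left (u u' v : EuclideanSpace ℝ (Fin 3)) : cross3 (u + u') v = cross3 u v + cross3 u' v := by
  ext i; fin_cases i <;> simp [cross3] <;> ring

/-- `cross3` is homogeneous in the first argument. -/
theorem cross3_smul_left (u v : EuclideanSpace ℝ (Fin 3)) (c : ℝ) : cross3 (c • u) v = c • cross3 u v := by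
  ext i; fin_cases i <;> simp [cross3] <;> ring

/-- `cross3 u u = 0`. -/
@[simp] theorem cross3_self (u : EuclideanSpace ℝ (Fin 3)) : cross3 u u = 0 := by
  ext i; fin_cases i <;> simp [cross3] <;> ring

/-- A vector is determined by its inner products: if `⟪x, y⟫ = ⟪x', y⟫` for all `y` then
`x = x'`. -/
theorem eq_of_forall_inner_eq {x x' : EuclideanSpace ℝ (Fin 3)} (h : ∀ y : EuclideanSpace ℝ (Fin 3), ⟪x, y⟫ = ⟪x', y⟫) : x = x' := by
  have : ⟪x - x', x - x'⟫ = 0 := by rw [inner_sub_left, h, sub_self]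
  exact sub_eq_zero.1 (inner_self_eq_zero.1 this)

/-- A nonnegative combination of `x, z` lies in their `ℝ≥0`-span. -/
theorem mem_span_pair_of_nonneg {x z : EuclideanSpace ℝ (Fin 3)} {a b : ℝ} (ha : 0 ≤ a) (hb : 0 ≤ b) :
    a • x + b • z ∈ Submodule.span NNReal {x, z} := by
  rw [Submodule.mem_span_pair]
  exact ⟨⟨a, ha⟩, ⟨b, hb⟩, by rw [NNReal.smul_def, NNReal.smul_def]; rfl⟩

/-! ## Part D. The clipped polygon -/

section Cut

variable {n k : ℕ} {w : ℕ → EuclideanSpace ℝ (Fin 3)} {ν : EuclideanSpace ℝ (Fin 3)} (hn : 3 ≤ n) (hper : ∀ i, w (i + n) = w i)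
  (hcx : ∀ i j k, i < j → j < k → k < i + n → 0 < orient3 (w i) (w j) (w k))
  (hk1 : 1 ≤ k) (hkn : k < n) (hpos : ∀ i, i < k → 0 < ⟪w i, ν⟫)
  (hnp : ∀ i, k ≤ i → i < n → ⟪w i, ν⟫ ≤ 0) (hneg : ∃ i, k ≤ i ∧ i < n ∧ ⟪w i, ν⟫ < 0)

/-- The cut polygon agrees with `w` on the kept vertices `j < k`. -/
theorem cutPoly_of_lt {j : ℕ} (hj : j < k) : cutPoly w ν n k j = w j := by
  unfold cutPoly; rw [Nat.mod_eq_of_lt (by omega), if_pos hj]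

/-- Vertex `k` of the cut polygon is the first chord point `cutB`. -/
theorem cutPoly_k : cutPoly w ν n k k = cutB w ν k := by
  unfold cutPoly; rw [Nat.mod_eq_of_lt (by omega), if_neg (lt_irrefl k), if_pos rfl]

/-- Vertex `k + 1` of the cut polygon is the second chord point `cutA`. -/
theorem cutPoly_k1 : cutPoly w ν n k (k + 1) = cutA w ν n := by
  unfold cutPoly
  rw [Nat.mod_eq_of_lt (by omega), if_neg (by omega), if_neg (by omega)]

/-- The cut polygon is periodic with period `k + 2`. -/
theorem cutPoly_periodic (j : ℕ) : cutPoly w ν n k (j + (k + 2)) = cutPoly w ν n k j := by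
  unfold cutPoly; rw [Nat.add_mod_right]

include hk1 in
/-- Vertex `k + 2` of the cut polygon is `w 0` again. -/
theorem cutPoly_k2 : cutPoly w ν n k (k + 2) = w 0 := by
  rw [show k + 2 = 0 + (k + 2) by ring, cutPoly_periodic, cutPoly_of_lt (by omega)]

include hcx hkn hpos hnp in
/-- Convexity, case `(w i, w j, B)`. -/
theorem orient3_cutB_pos {i j : ℕ} (hij : i < j) (hjk : j < k) :
    0 < orient3 (w i) (w j) (cutB w ν k) := by
  unfold cutB
  rw [orient3_add_right, orient3_smul_right, orient3_smul_right]
  have h1 : 0 < orient3 (w i) (w j) (w k) := hcx i j k hij hjk (by omega)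
  have h2 : 0 ≤ orient3 (w i) (w j) (w (k - 1)) := by
    rcases Nat.lt_or_ge j (k - 1) with h | h
    · exact (hcx i j (k - 1) hij h (by omega)).le
    · rw [show k - 1 = j by omega, orient3_self_right]
  have hb1 := hpos (k - 1) (by omega)
  have hb2 : 0 ≤ -⟪w k, ν⟫ := neg_nonneg.2 (hnp k le_rfl hkn)
  nlinarith [mul_pos hb1 h1, mul_nonneg hb2 h2]

include hn hcx hk1 hkn hpos hnp in
/-- Convexity, case `(w i, w j, A)`. -/
theorem orient3_cutA_pos {i j : ℕ} (hij : i < j) (hjk : j < k) :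
    0 < orient3 (w i) (w j) (cutA w ν n) := by
  unfold cutA
  rw [orient3_add_right, orient3_smul_right, orient3_smul_right]
  have h1 : 0 < orient3 (w i) (w j) (w (n - 1)) := hcx i j (n - 1) hij (by omega) (by omega)
  have h2 : 0 ≤ orient3 (w i) (w j) (w 0) := by
    rcases Nat.eq_zero_or_pos i with h | h
    · rw [h, orient3_self_outer]
    · rw [← orient3_cyclic]; exact (hcx 0 i j h hij (by omega)).le
  have ha1 := hpos 0 (by omega)
  have ha2 : 0 ≤ -⟪w (n - 1), ν⟫ := neg_nonneg.2 (hnp (n - 1) (by omega) (by omega))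
  nlinarith [mul_pos ha1 h1, mul_nonneg ha2 h2]

include hn hcx hk1 hkn hpos hnp hneg in
/-- Convexity, case `(w i, B, A)`. -/
theorem orient3_cutB_cutA_pos {i : ℕ} (hik : i < k) :
    0 < orient3 (w i) (cutB w ν k) (cutA w ν n) := by
  unfold cutB cutA
  simp only [orient3_add_mid, orient3_smul_mid, orient3_add_right, orient3_smul_right]
  -- the four orientation values are `≥ 0`
  have hT1 : 0 ≤ orient3 (w i) (w k) (w (n - 1)) := by
    rcases Nat.lt_or_ge k (n - 1) with h | h
    · exact (hcx i k (n - 1) hik h (by omega)).le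
    · rw [show n - 1 = k by omega, orient3_self_right]
  have hT2 : 0 ≤ orient3 (w i) (w k) (w 0) := by
    rcases Nat.eq_zero_or_pos i with h | h
    · rw [h, orient3_self_outer]
    · rw [← orient3_cyclic]; exact (hcx 0 i k h hik (by omega)).le
  have hT3 : 0 ≤ orient3 (w i) (w (k - 1)) (w (n - 1)) := by
    rcases Nat.lt_or_ge i (k - 1) with h | h
    · exact (hcx i (k - 1) (n - 1) h (by omega) (by omega)).le
    · rw [show k - 1 = i by omega, orient3_self_left]
  have hT4 : 0 ≤ orient3 (w i) (w (k - 1)) (w 0) := by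
    rcases Nat.eq_zero_or_pos i with h | h
    · rw [h, orient3_self_outer]
    · rcases Nat.lt_or_ge i (k - 1) with h' | h'
      · rw [← orient3_cyclic]; exact (hcx 0 i (k - 1) h h' (by omega)).le
      · rw [show k - 1 = i by omega, orient3_self_left]
  have hb1 := hpos (k - 1) (by omega)
  have hb2 : 0 ≤ -⟪w k, ν⟫ := neg_nonneg.2 (hnp k le_rfl hkn)
  have ha1 := hpos 0 (by omega)
  have ha2 : 0 ≤ -⟪w (n - 1), ν⟫ := neg_nonneg.2 (hnp (n - 1) (by omega) (by omega))
  have p1 : 0 ≤ ⟪w (k - 1), ν⟫ * (⟪w 0, ν⟫ * orient3 (w i) (w k) (w (n - 1))) :=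
    mul_nonneg hb1.le (mul_nonneg ha1.le hT1)
  have p2 : 0 ≤ ⟪w (k - 1), ν⟫ * (-⟪w (n - 1), ν⟫ * orient3 (w i) (w k) (w 0)) :=
    mul_nonneg hb1.le (mul_nonneg ha2 hT2)
  have p3 : 0 ≤ -⟪w k, ν⟫ * (⟪w 0, ν⟫ * orient3 (w i) (w (k - 1)) (w (n - 1))) :=
    mul_nonneg hb2 (mul_nonneg ha1.le hT3)
  have p4 : 0 ≤ -⟪w k, ν⟫ * (-⟪w (n - 1), ν⟫ * orient3 (w i) (w (k - 1)) (w 0)) :=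
    mul_nonneg hb2 (mul_nonneg ha2 hT4)
  -- one of them is strictly positive
  rcases Nat.lt_or_ge k (n - 1) with hk | hk
  · have hs : 0 < ⟪w (k - 1), ν⟫ * (⟪w 0, ν⟫ * orient3 (w i) (w k) (w (n - 1))) :=
      mul_pos hb1 (mul_pos ha1 (hcx i k (n - 1) hik hk (by omega)))
    nlinarith
  · -- `k = n − 1`: the cut block is `{n−1}`, strictly negative
    have hkeq : k = n - 1 := by omega
    obtain ⟨i₀, hi₀k, hi₀n, hi₀⟩ := hneg
    have hi₀eq : i₀ = n - 1 := by omega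
    rw [hi₀eq] at hi₀
    have ha2' : 0 < -⟪w (n - 1), ν⟫ := by linarith
    have hb2' : 0 < -⟪w k, ν⟫ := by rw [hkeq]; exact ha2'
    rcases Nat.lt_or_ge i (k - 1) with hi | hi
    · have hs : 0 < -⟪w k, ν⟫ * (⟪w 0, ν⟫ * orient3 (w i) (w (k - 1)) (w (n - 1))) :=
        mul_pos hb2' (mul_pos ha1 (hcx i (k - 1) (n - 1) hi (by omega) (by omega)))
      nlinarith
    · have hieq : i = k - 1 := by omega
      have hi0 : 0 < i := by omega
      have hs : 0 < ⟪w (k - 1), ν⟫ * (-⟪w (n - 1), ν⟫ * orient3 (w i) (w k) (w 0)) := by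
        refine mul_pos hb1 (mul_pos ha2' ?_)
        rw [← orient3_cyclic]; exact hcx 0 i k hi0 hik (by omega)
      nlinarith

include hn hcx hk1 hkn hpos hnp hneg in
/-- **The clipped polygon is in convex position** (one period). -/
theorem cutPoly_convex_std : ∀ i j l, i < j → j < l → l < k + 2 →
    0 < orient3 (cutPoly w ν n k i) (cutPoly w ν n k j) (cutPoly w ν n k l) := by
  intro i j l hij hjl hl
  rcases Nat.lt_or_ge l k with hlk | hlk
  · rw [cutPoly_of_lt (by omega), cutPoly_of_lt (by omega), cutPoly_of_lt hlk]
    exact hcx i j l hij hjl (by omega)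
  · rcases Nat.lt_or_ge j k with hjk | hjk
    · rw [cutPoly_of_lt (by omega), cutPoly_of_lt hjk]
      rcases eq_or_lt_of_le hlk with h | h
      · rw [← h, cutPoly_k]; exact orient3_cutB_pos hcx hkn hpos hnp hij hjk
      · rw [show l = k + 1 by omega, cutPoly_k1]; exact orient3_cutA_pos hn hcx hk1 hkn hpos hnp hij hjk
    · have hj : j = k := by omega
      have hl' : l = k + 1 := by omega
      rw [cutPoly_of_lt (by omega), hj, cutPoly_k, hl', cutPoly_k1]
      exact orient3_cutB_cutA_pos hn hcx hk1 hkn hpos hnp hneg (by omega)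

/-! ### Signs and inheritance of the new vertices -/

include hpos in
/-- Every vertex of the clipped polygon is on the closed positive side of `ν`. -/
theorem cutPoly_inner_nonneg (j : ℕ) : 0 ≤ ⟪cutPoly w ν n k j, ν⟫ := by
  unfold cutPoly
  split_ifs with h1 h2
  · exact (hpos _ h1).le
  · unfold cutB; rw [inner_add_left, real_inner_smul_left, real_inner_smul_left]; nlinarith
  · unfold cutA; rw [inner_add_left, real_inner_smul_left, real_inner_smul_left]; nlinarith

include hn hk1 hkn hpos hnp in
/-- The vertices of the clipped polygon inherit every closed half-space containing all the
vertices of `w`. -/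
theorem cutPoly_inherit {μ : EuclideanSpace ℝ (Fin 3)} (hμ : ∀ i, i < n → 0 ≤ ⟪w i, μ⟫) (j : ℕ) :
    0 ≤ ⟪cutPoly w ν n k j, μ⟫ := by
  unfold cutPoly
  split_ifs with h1 h2
  · exact hμ _ (by omega)
  · unfold cutB; rw [inner_add_left, real_inner_smul_left, real_inner_smul_left]
    exact add_nonneg (mul_nonneg (hpos (k - 1) (by omega)).le (hμ k hkn))
      (mul_nonneg (neg_nonneg.2 (hnp k le_rfl hkn)) (hμ (k - 1) (by omega)))
  · unfold cutA; rw [inner_add_left, real_inner_smul_left, real_inner_smul_left]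
    exact add_nonneg (mul_nonneg (hpos 0 (by omega)).le (hμ (n - 1) (by omega)))
      (mul_nonneg (neg_nonneg.2 (hnp (n - 1) (by omega) (by omega))) (hμ 0 (by omega)))

/-! ### The new edge lies on the cutting circle -/

include hn hcx hk1 hkn hpos hnp hneg in
/-- The edge functional of the new edge `(B, A)` is a positive multiple of `⟪·, ν⟫`:
`orient3 B A y = (orient3 B A (w 0) / ⟪w 0, ν⟫) · ⟪y, ν⟫` (Cramer in the basis `B, A, w 0`). -/
theorem orient3_cutB_cutA_eq (y : EuclideanSpace ℝ (Fin 3)) :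
    orient3 (cutB w ν k) (cutA w ν n) y =
      orient3 (cutB w ν k) (cutA w ν n) (w 0) / ⟪w 0, ν⟫ * ⟪y, ν⟫ := by
  have hD : 0 < orient3 (cutB w ν k) (cutA w ν n) (w 0) := by
    rw [← orient3_cyclic]; exact orient3_cutB_cutA_pos hn hcx hk1 hkn hpos hnp hneg (by omega)
  have h0 := hpos 0 (by omega)
  have hB : ⟪cutB w ν k, ν⟫ = 0 := by
    unfold cutB; rw [inner_add_left, real_inner_smul_left, real_inner_smul_left]; ring
  have hA : ⟪cutA w ν n, ν⟫ = 0 := by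
    unfold cutA; rw [inner_add_left, real_inner_smul_left, real_inner_smul_left]; ring
  have hexp := orient3_expand (cutB w ν k) (cutA w ν n) (w 0) y
  have h := congrArg (fun v => ⟪v, ν⟫) hexp
  simp only [inner_add_left, real_inner_smul_left, hB, hA, mul_zero, zero_add] at h
  -- `h : D ⟪y,ν⟫ = o(B,A,y) σ_0`
  rw [div_mul_eq_mul_div, eq_div_iff h0.ne']
  linarith

include hn hcx hk1 hkn hpos hnp hneg in
/-- The cross product of the new edge is a positive multiple of `ν`. -/
theorem cross3_cutB_cutA : cross3 (cutB w ν k) (cutA w ν n) =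
    (orient3 (cutB w ν k) (cutA w ν n) (w 0) / ⟪w 0, ν⟫) • ν := by
  apply eq_of_forall_inner_eq
  intro y
  rw [inner_cross3_left, real_inner_smul_left, orient3_cutB_cutA_eq hn hcx hk1 hkn hpos hnp hneg,
    real_inner_comm y ν]

/-! ### The cone of the clipped polygon -/

include hn hper hcx hk1 hkn hpos hnp hneg in
/-- **The clipped cone contains the old cone cut by the half-space**: a point on the closed
positive side of every edge plane of `w` and of `ν` is on the closed positive side of every edge
plane of the clipped polygon. -/
theorem cutPoly_cone {y : EuclideanSpace ℝ (Fin 3)} (hy : ∀ i, i < n → 0 ≤ orient3 (w i) (w (i + 1)) y)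
    (hyν : 0 ≤ ⟪y, ν⟫) : ∀ j, j < k + 2 →
      0 ≤ orient3 (cutPoly w ν n k j) (cutPoly w ν n k (j + 1)) y := by
  intro j hj
  rcases Nat.lt_or_ge (j + 1) k with h1 | h1
  · rw [cutPoly_of_lt (by omega), cutPoly_of_lt h1]; exact hy j (by omega)
  · rcases eq_or_lt_of_le h1 with h2 | h2
    · -- edge `(w (k−1), B)`
      rw [cutPoly_of_lt (by omega), ← h2, cutPoly_k]
      unfold cutB
      rw [orient3_add_mid, orient3_smul_mid, orient3_smul_mid, show k - 1 = j by omega,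
        orient3_self_left, mul_zero, add_zero, show k = j + 1 by omega]
      exact mul_nonneg (hpos j (by omega)).le (hy j (by omega))
    · rcases eq_or_lt_of_le (Nat.succ_le_of_lt h2) with h3 | h3
      · -- edge `(B, A)`
        have hj : j = k := by omega
        rw [hj, cutPoly_k, cutPoly_k1, orient3_cutB_cutA_eq hn hcx hk1 hkn hpos hnp hneg]
        apply mul_nonneg _ hyν
        apply div_nonneg _ (hpos 0 (by omega)).le
        rw [← orient3_cyclic]
        exact (orient3_cutB_cutA_pos hn hcx hk1 hkn hpos hnp hneg (by omega)).le
      · -- edge `(A, w 0)`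
        have hj : j = k + 1 := by omega
        rw [hj, cutPoly_k1, cutPoly_k2 hk1]
        unfold cutA
        rw [orient3_add_left, orient3_smul_left, orient3_smul_left, orient3_self_left, mul_zero,
          add_zero]
        have h := hy (n - 1) (by omega)
        rw [show n - 1 + 1 = n by omega, show w n = w 0 by rw [← hper 0, zero_add]] at h
        exact mul_nonneg (hpos 0 (by omega)).le h

/-! ### Caps stay inside -/

include hn hper hcx hk1 hkn hpos hnp hneg in
/-- **Caps transfer.** If every edge plane of `w` and the cutting plane are at height `≥ s`
over `z` (`s ‖w i × w (i+1)‖ ≤ orient3 (w i) (w (i+1)) z`, `s ‖ν‖ ≤ ⟪ν, z⟫`), then every edge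
plane of the clipped polygon is at height `≥ s` over `z`. -/
theorem cutPoly_caps {z : EuclideanSpace ℝ (Fin 3)} {s : ℝ}
    (hz : ∀ i, i < n → s * ‖cross3 (w i) (w (i + 1))‖ ≤ orient3 (w i) (w (i + 1)) z)
    (hνz : s * ‖ν‖ ≤ ⟪ν, z⟫) : ∀ j, j < k + 2 →
      s * ‖cross3 (cutPoly w ν n k j) (cutPoly w ν n k (j + 1))‖ ≤
        orient3 (cutPoly w ν n k j) (cutPoly w ν n k (j + 1)) z := by
  intro j hj
  rcases Nat.lt_or_ge (j + 1) k with h1 | h1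
  · rw [cutPoly_of_lt (by omega), cutPoly_of_lt h1]; exact hz j (by omega)
  · rcases eq_or_lt_of_le h1 with h2 | h2
    · -- edge `(w (k−1), B) = σ(k−1) · edge (k−1, k)`
      rw [cutPoly_of_lt (by omega), ← h2, cutPoly_k]
      unfold cutB
      rw [cross3_add_right, cross3_smul_right, cross3_smul_right, show k - 1 = j by omega,
        cross3_self, smul_zero, add_zero, orient3_add_mid, orient3_smul_mid, orient3_smul_mid,
        orient3_self_left, mul_zero, add_zero, norm_smul, Real.norm_eq_abs,
        abs_of_pos (hpos j (by omega)), show k = j + 1 by omega]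
      have h := mul_le_mul_of_nonneg_left (hz j (by omega)) (hpos j (by omega)).le
      linarith [h]
    · rcases eq_or_lt_of_le (Nat.succ_le_of_lt h2) with h3 | h3
      · -- edge `(B, A)`: cross product `= c ν`, functional `= c ⟪·,ν⟫`
        have hj' : j = k := by omega
        have hc : 0 < orient3 (cutB w ν k) (cutA w ν n) (w 0) / ⟪w 0, ν⟫ := by
          apply div_pos _ (hpos 0 (by omega))
          rw [← orient3_cyclic]
          exact orient3_cutB_cutA_pos hn hcx hk1 hkn hpos hnp hneg (by omega)
        have hcr := cross3_cutB_cutA hn hcx hk1 hkn hpos hnp hneg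
        have hoz := orient3_cutB_cutA_eq hn hcx hk1 hkn hpos hnp hneg z
        set c := orient3 (cutB w ν k) (cutA w ν n) (w 0) / ⟪w 0, ν⟫ with hcdef
        rw [hj', cutPoly_k, cutPoly_k1, hcr, hoz, norm_smul, Real.norm_eq_abs, abs_of_pos hc,
          real_inner_comm]
        nlinarith [mul_le_mul_of_nonneg_left hνz hc.le]
      · -- edge `(A, w 0) = σ 0 · edge (n−1, n)`
        have hj' : j = k + 1 := by omega
        rw [hj', cutPoly_k1, cutPoly_k2 hk1]
        unfold cutA
        rw [cross3_add_left, cross3_smul_left, cross3_smul_left, cross3_self, smul_zero, add_zero,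
          orient3_add_left, orient3_smul_left, orient3_smul_left, orient3_self_left, mul_zero,
          add_zero, norm_smul, Real.norm_eq_abs, abs_of_pos (hpos 0 (by omega))]
        have h := hz (n - 1) (by omega)
        rw [show n - 1 + 1 = n by omega, show w n = w 0 by rw [← hper 0, zero_add]] at h
        have h' := mul_le_mul_of_nonneg_left h (hpos 0 (by omega)).le
        linarith [h']

end Cut


end Summit.Ventures.Crystal3D

end
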